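import Summits.KontsevichZagierPeriods.KontsevichZagierPeriods.Theorems.RootDecompQuadraticDescentPair18HomotopyAngP11

/-! # `RootDecompQuadraticDescentPair18HomotopyAngP12` — part 12/20 of the mechanical ≤400-line split of `Pair18HomotopyAng_v13_landing.lean` (sha256 01bf0af4c8d09f43…)
Source: decomp-kz lens-6 g9 `Pair18HomotopyAng.lean` v13 (HOME/decomp-kz-lens-6/g9/, sha256 bd7fcda1…; critic g5 19:35:56Z CLEARED «angle side of #18 PROVED»: hTh7_holds, hB17_holds, hAng4_holds with no hypotheses) — companion file #2 of Pair18Homotopy v14 (landed as …Pair18HomotopyP01–P31): the verbatim COPIED PRELUDE is dropped in favour of those landed declarations, the four homonyms with different bodies are renamed (Th7_eq', TriA, isSemialgebraic_TriA, volume_diag'), `#print axioms` pins removed.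
Split by census-1 g9 `gen/splitlean.py`: scopes re-opened with their `open`/`variable`/`set_option` context; mathematics and declaration order unchanged. -/

set_option linter.unusedSimpArgs false
noncomputable section
open _root_.Set MvPolynomial
namespace Summit.KontsevichZagierPeriods.RootDecompQuadraticDescent.Pair18Homotopy
open Literature.NumberTheory.Transcendental
open Literature.NumberTheory.Transcendental.KZ (RFun cube)
open Summit.KontsevichZagierPeriods.RootDecompQuadraticDescent.DarkPairs (rel_reflect_rep rel_double)
section Fold
open Literature.ModelTheory.ExponentialFields (IsSemialgebraic isSemialgebraic_setOf_eval_le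
  isSemialgebraic_setOf_eval_pos isSemialgebraic_setOf_eval_nonneg isSemialgebraic_setOf_eval_eq_zero)

open _root_.Set MvPolynomial in
open Literature.NumberTheory.Transcendental in
open Literature.NumberTheory.Transcendental.KZ (RFun cube) in
open Summit.KontsevichZagierPeriods.RootDecompQuadraticDescent.DarkPairs (rel_reflect_rep rel_double) in
/-- Auxiliary step `vec2_1` (§2b): vec2 1. [bookkeeping] -/
private theorem vec2_1 (a b : ℝ) : (![a, b] : Fin 2 → ℝ) 1 = b := rfl

open _root_.Set MvPolynomial in
open Literature.NumberTheory.Transcendental in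
open Literature.NumberTheory.Transcendental.KZ (RFun cube) in
open Summit.KontsevichZagierPeriods.RootDecompQuadraticDescent.DarkPairs (rel_reflect_rep rel_double) in
/-- Auxiliary step `vec2_0` (§2b): vec2 0. [bookkeeping] -/
private theorem vec2_0 (a b : ℝ) : (![a, b] : Fin 2 → ℝ) 0 = a := rfl

open _root_.Set MvPolynomial in
open Literature.NumberTheory.Transcendental in
open Literature.NumberTheory.Transcendental.KZ (RFun cube) in
open Summit.KontsevichZagierPeriods.RootDecompQuadraticDescent.DarkPairs (rel_reflect_rep rel_double) in
/-- Auxiliary step `cube2` (§0): cube2. [bookkeeping] -/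
private theorem cube2 {x : Fin 2 → ℝ} (hx : x ∈ KZ.cube 2) : (0 ≤ x 0 ∧ x 0 ≤ 1) ∧ (0 ≤ x 1 ∧ x 1 ≤ 1) := ⟨hx 0, hx 1⟩

/-- **hAng4 ⟸ hLat₃**: `3[R₀] + [R₁] + [B] + [Trap'_lo] + [Trap'_hi] + [Ũ₋'] ≡ [Th7] − 2[B17]`, where
`[Th7] − 2[B17] ≡ 2[Sqα] + 3[R₀] + [R₁] + [B]` in the `B17` chart (NODE §9.23): left are `Trap'_hi ↦ Sqα` and
`Ũ₋' ↦ swap Trap'_lo` (by `AngH_shear` + the reflection `Q ↦ −Q`), one diagonal cut, and the four `1/√7`-scalings. -/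
theorem hAng4_of_lattice3
    (hLat : 3 • KZ.of AngHFanLo + KZ.of AngHMrectHi + KZ.of AngHBsq + KZ.of AngHTrapLo + KZ.of AngHTrapHi
      + KZ.of AngHUmr - KZ.of Th7.rep + 2 • KZ.of B17.rep ∈ KZ.relations) :
    KZ.of AngHM + KZ.of AngHp + KZ.of AngHm - KZ.of Th7.rep + 2 • KZ.of B17.rep ∈ KZ.relations := by
  have h := add_mem hAng4_lattice3 hLat
  convert h using 1
  abel

/-! ### §19o  `Trap'_hi ↦ Sqα`, `Ũ₋' ↦ Sqα ∩ {Q ≥ P}`, `Trap'_lo = Sqα ∩ {Q ≤ P}`:  the three shear-cells are `2·[Sqα]`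

With the generic shear `AngH_shear` (§19n) and a generic reflection `AngH_reflect` (`Q ↦ −Q`, i.e. `ψ ↦ −ψ`):
* `Trap'_hi = {α₁ ≤ … : φ ≤ v ≤ φ+α₁, φ ≤ α₁}` ↦ (`v ↦ φ−v`) `SqαN = {φ ≤ α₁, −α₁ ≤ v ≤ 0}` ↦ (`v ↦ −v`)
  `Sqα = {φ ≤ α₁, 0 ≤ v ≤ α₁} = [0,α₁]²`;
* `Ũ₋' = {v ≥ 0, φ + v ≤ α₁}` ↦ (`v ↦ −v`) `ŨN = {v ≤ 0, φ − v ≤ α₁}` ↦ (`v ↦ φ−v`) `Sqα ∩ {v ≥ φ}`;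
* `Sqα = (Sqα ∩ {v ≤ φ}) ⊔ (Sqα ∩ {v ≥ φ})` and `Sqα ∩ {v ≤ φ} = Trap'_lo`.
Hence `[Trap'_lo] + [Trap'_hi] + [Ũ₋'] ≡ 2·[Sqα]` and hAng4 ⟸ hLat₄ : `2[Sqα] + 3[R₀] + [R₁] + [B] ≡ [Th7] − 2[B17]`,
every cell now an axis-parallel LATTICE RECTANGLE in the angle chart. -/

/-- the reflection `(s,w) ↦ (s, 1−w)` (`Q ↦ −Q`, `ψ ↦ −ψ`). -/
def Rf (z : Fin 2 → ℝ) : Fin 2 → ℝ := ![z 0, 1 - z 1]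
/-- Auxiliary step `Rf_zero` (§19o): Rf zero. [bookkeeping] -/
theorem Rf_zero (z : Fin 2 → ℝ) : Rf z 0 = z 0 := rfl
/-- Auxiliary step `Rf_one` (§19o): Rf one. [bookkeeping] -/
theorem Rf_one (z : Fin 2 → ℝ) : Rf z 1 = 1 - z 1 := rfl
/-- Auxiliary step `Rf_Q` (§19o): Rf Q. [bookkeeping] -/
theorem Rf_Q (z : Fin 2 → ℝ) : 4 * Rf z 1 - 2 = -(4 * z 1 - 2) := by rw [Rf_one]; ring
/-- Auxiliary step `Rf_invol` (§19o): Rf invol. [bookkeeping] -/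
theorem Rf_invol (z : Fin 2 → ℝ) : Rf (Rf z) = z := by
  funext i
  fin_cases i
  · rfl
  · show Rf (Rf z) 1 = z 1
    rw [Rf_one, Rf_one]; ring
/-- Auxiliary step `Rf_cube` (§19o): Rf cube. [bookkeeping] -/
theorem Rf_cube {z : Fin 2 → ℝ} (hz : z ∈ cube 2) : Rf z ∈ cube 2 := by
  have h0 := (cube2 hz).1
  have h1 := (cube2 hz).2
  intro i
  fin_cases i
  · exact h0
  · show 0 ≤ Rf z 1 ∧ Rf z 1 ≤ 1
    rw [Rf_one]; constructor <;> linarith [h1.1, h1.2]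

/-- **The reflection as a KZ-move**: `[AngH | S] ≡ [AngH | T]` whenever `Rf(S) ⊆ T`, `Rf(T) ⊆ S`. -/
theorem AngH_reflect {S T : Set (Fin 2 → ℝ)} (hS : IsSemialgebraic ℚ S) (hT : IsSemialgebraic ℚ T)
    (hSc : S ⊆ cube 2) (hTc : T ⊆ cube 2) (hST : ∀ z ∈ S, Rf z ∈ T) (hTS : ∀ w ∈ T, Rf w ∈ S) :
    KZ.of (AngH.rep.restrict S hS hSc) - KZ.of (AngH.rep.restrict T hT hTc) ∈ KZ.relations := by
  let Mz : Matrix (Fin 2) (Fin 2) ℝ := !![1, 0; 0, -1]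
  let Φ' : (Fin 2 → ℝ) → (Fin 2 → ℝ) →L[ℝ] (Fin 2 → ℝ) := fun _ =>
    LinearMap.toContinuousLinearMap (Matrix.toLin' Mz)
  have hΦ'ap : ∀ z w, Φ' z w = ![w 0, -w 1] := by
    intro z w; funext i
    fin_cases i <;> simp [Φ', Mz, Matrix.toLin'_apply, Matrix.mulVec, dotProduct, Fin.sum_univ_two]
  have hdet : ∀ z, (Φ' z).det = -1 := by
    intro z
    unfold ContinuousLinearMap.det
    simp [Φ', LinearMap.det_toLin', Mz, Matrix.det_fin_two]
  have hdom : (AngH.rep.restrict T hT hTc).domain = Rf '' (AngH.rep.restrict S hS hSc).domain := by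
    simp only [KZ.IntegralRep.domain_restrict]
    ext w
    constructor
    · intro hw
      exact ⟨Rf w, hTS w hw, Rf_invol w⟩
    · rintro ⟨z, hz, rfl⟩
      exact hST z hz
  refine KZ.changeOfVariablesRel_subset_relations
    ⟨2, AngH.rep.restrict S hS hSc, AngH.rep.restrict T hT hTc, Rf, Φ', ?_, ?_, ?_, hdom, ?_, rfl⟩
  · have hsd : IsSemialgebraic ℚ (AngH.rep.restrict S hS hSc).domain :=
      (AngH.rep.restrict S hS hSc).isSemialgebraic_domain
    refine (isSemialgebraicMapOn_iff_forall_holds hsd).mpr fun i => ?_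
    fin_cases i
    · exact (isSemialgebraicFunOn_aeval hsd (X 0)).congr fun z _ => by
        simp only [Rf, Fin.zero_eta, Matrix.cons_val_zero, aeval_X]
    · exact (isSemialgebraicFunOn_aeval hsd (C 1 - X 1)).congr fun z _ => by
        simp only [Rf, Fin.mk_one, Matrix.cons_val_one, Matrix.head_cons, Matrix.cons_val_fin_one, map_sub,
          aeval_C, aeval_X, eq_ratCast, Rat.cast_one]
  · intro z hz
    have hA := hasFDerivAt_apply (𝕜 := ℝ) 0 z
    have hB := hasFDerivAt_apply (𝕜 := ℝ) 1 z
    have hB' := hB.const_sub (1:ℝ)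
    have hpi : HasFDerivAt Rf (Φ' z) z := by
      rw [hasFDerivAt_pi']
      intro i
      fin_cases i
      · refine (hA.congr_fderiv ?_).congr_of_eventuallyEq (Filter.Eventually.of_forall fun y => ?_)
        · ext w
          simp [hΦ'ap]
        · simp only [Fin.zero_eta, Rf_zero]
      · refine (hB'.congr_fderiv ?_).congr_of_eventuallyEq (Filter.Eventually.of_forall fun y => ?_)
        · ext w
          simp [hΦ'ap]
        · simp only [Fin.mk_one, Rf_one]
    exact hpi.hasFDerivWithinAt
  · intro z₁ hz₁ z₂ hz₂ heq
    have h := congr_arg Rf heq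
    rwa [Rf_invol, Rf_invol] at h
  · intro z hz
    rw [hdet z, abs_neg, abs_one, mul_one]
    simp only [KZ.IntegralRep.integrand_restrict, RFun.rep_integrand]
    simp only [AngH, AngDen, RFun.fn, Rf, map_add, map_sub, map_mul, aeval_C, aeval_X, eq_ratCast, Rat.cast_one,
      Rat.cast_ofNat, vec2_0, vec2_1, Matrix.cons_val_zero, Matrix.cons_val_one, Matrix.head_cons]
    ring

/-- Auxiliary step `isSemialgebraic_sU1` (§19o): is Semialgebraic s U1. [bookkeeping] -/
theorem isSemialgebraic_sU1 : IsSemialgebraic ℚ sU1 :=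
  isSemialgebraic_of_le (C 2) (C 4 * X 1) sU1 fun z => by
    simp only [sU1, mem_setOf_eq, map_mul, aeval_C, aeval_X, eq_ratCast, Rat.cast_ofNat]
/-- Auxiliary step `isSemialgebraic_sQn` (§19o): is Semialgebraic s Qn. [bookkeeping] -/
theorem isSemialgebraic_sQn : IsSemialgebraic ℚ sQn :=
  isSemialgebraic_of_le (C 4 * X 1) (C 2) sQn fun z => by
    simp only [sQn, mem_setOf_eq, map_mul, aeval_C, aeval_X, eq_ratCast, Rat.cast_ofNat]
/-- Auxiliary step `isSemialgebraic_sU3` (§19o): is Semialgebraic s U3. [bookkeeping] -/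
theorem isSemialgebraic_sU3 : IsSemialgebraic ℚ sU3 :=
  isSemialgebraic_of_le (C 7 * ((C 2 * X 0 - (C 4 * X 1 - C 2)) * (C 2 * X 0 - (C 4 * X 1 - C 2))))
    ((C 1 + C 2 * X 0 * (C 4 * X 1 - C 2)) * (C 1 + C 2 * X 0 * (C 4 * X 1 - C 2))) sU3 fun z => by
    simp only [sU3, mem_setOf_eq, map_mul, map_sub, map_add, aeval_C, aeval_X, eq_ratCast, Rat.cast_ofNat,
      Rat.cast_one]
/-- Auxiliary step `isSemialgebraic_sU5r` (§19o): is Semialgebraic s U5r. [bookkeeping] -/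
theorem isSemialgebraic_sU5r : IsSemialgebraic ℚ sU5r :=
  isSemialgebraic_of_le (C 4 * X 0) (C 1) sU5r fun z => by
    simp only [sU5r, mem_setOf_eq, map_mul, aeval_C, aeval_X, eq_ratCast, Rat.cast_ofNat, Rat.cast_one]

/-- descale an inequality by a positive square. -/
theorem seven_sq_le_of_scaled {a b D : ℝ} (hD : 0 < D) (h : 7 * ((a * D) * (a * D)) ≤ (b * D) * (b * D)) :
    7 * (a * a) ≤ b * b := by
  by_contra hn
  have hn' := not_le.mp hn
  nlinarith [mul_lt_mul_of_pos_right hn' (mul_pos hD hD)]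

/-- `Sqα = [0,α₁]² = {7P² ≤ 1, Q ≥ 0, 7Q² ≤ 1}`, its mirror `SqαN = {7P² ≤ 1, Q ≤ 0, 7Q² ≤ 1}`, its two
halves along `Q = P`, and the mirror `ŨN` of `Ũ₋'`. -/
def Sqα : Set (Fin 2 → ℝ) := cube 2 ∩ (sK2 ∩ sU1 ∩ sQa)
/-- Auxiliary definition `SqαN` (§19o): SqαN. [bookkeeping] -/
def SqαN : Set (Fin 2 → ℝ) := cube 2 ∩ (sK2 ∩ sQn ∩ sQa)
/-- Auxiliary definition `SqαD` (§19o): SqαD. [bookkeeping] -/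
def SqαD : Set (Fin 2 → ℝ) := Sqα ∩ sDl
/-- Auxiliary definition `SqαU` (§19o): SqαU. [bookkeeping] -/
def SqαU : Set (Fin 2 → ℝ) := Sqα ∩ sDu
/-- Auxiliary definition `UMrN` (§19o): UMr N. [bookkeeping] -/
def UMrN : Set (Fin 2 → ℝ) := cube 2 ∩ (sQn ∩ sU3 ∩ sU4 ∩ sU5r)
/-- Auxiliary step `isSemialgebraic_Sqα` (§19o): is Semialgebraic Sqα. [bookkeeping] -/
theorem isSemialgebraic_Sqα : IsSemialgebraic ℚ Sqα :=
  KZ.isSemialgebraic_cube.inter ((isSemialgebraic_sK2.inter isSemialgebraic_sU1).inter isSemialgebraic_sQa)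
/-- Auxiliary step `isSemialgebraic_SqαN` (§19o): is Semialgebraic SqαN. [bookkeeping] -/
theorem isSemialgebraic_SqαN : IsSemialgebraic ℚ SqαN :=
  KZ.isSemialgebraic_cube.inter ((isSemialgebraic_sK2.inter isSemialgebraic_sQn).inter isSemialgebraic_sQa)
/-- Auxiliary step `isSemialgebraic_UMrN` (§19o): is Semialgebraic UMr N. [bookkeeping] -/
theorem isSemialgebraic_UMrN : IsSemialgebraic ℚ UMrN :=
  KZ.isSemialgebraic_cube.inter
    (((isSemialgebraic_sQn.inter isSemialgebraic_sU3).inter isSemialgebraic_sU4).inter isSemialgebraic_sU5r)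
/-- Auxiliary definition `AngHSqα` (§19o): Ang HSqα. [bookkeeping] -/
def AngHSqα : KZ.IntegralRep 2 := AngH.rep.restrict Sqα isSemialgebraic_Sqα (fun _ hz => hz.1)
/-- Auxiliary definition `AngHSqαN` (§19o): Ang HSqαN. [bookkeeping] -/
def AngHSqαN : KZ.IntegralRep 2 := AngH.rep.restrict SqαN isSemialgebraic_SqαN (fun _ hz => hz.1)
/-- Auxiliary definition `AngHSqαD` (§19o): Ang HSqαD. [bookkeeping] -/
def AngHSqαD : KZ.IntegralRep 2 :=
  AngH.rep.restrict SqαD (isSemialgebraic_Sqα.inter isSemialgebraic_sDl) (fun _ hz => hz.1.1)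
/-- Auxiliary definition `AngHSqαU` (§19o): Ang HSqαU. [bookkeeping] -/
def AngHSqαU : KZ.IntegralRep 2 :=
  AngH.rep.restrict SqαU (isSemialgebraic_Sqα.inter isSemialgebraic_sDu) (fun _ hz => hz.1.1)
/-- Auxiliary definition `AngHUmrN` (§19o): Ang HUmr N. [bookkeeping] -/
def AngHUmrN : KZ.IntegralRep 2 := AngH.rep.restrict UMrN isSemialgebraic_UMrN (fun _ hz => hz.1)

set_option maxHeartbeats 1600000 in
/-- **`[AngH | Trap'_hi] ≡ [AngH | SqαN]`** (`v ↦ φ − v`). -/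
theorem AngHTrapHi_SqαN : KZ.of AngHTrapHi - KZ.of AngHSqαN ∈ KZ.relations := by
  refine AngH_shear isSemialgebraic_TrapHi isSemialgebraic_SqαN (fun _ hz => hz.1) (fun _ hz => hz.1)
    (fun z hz => ?_) (fun w hw => ?_) (fun z hz => ?_) (fun w hw => ?_)
  · obtain ⟨hc, ⟨⟨⟨u2, u3⟩, q1⟩, k2⟩⟩ := hz
    have h0 := (cube2 hc).1
    simp only [sU2m, mem_setOf_eq] at u2
    nlinarith [mul_nonneg h0.1 (by linarith [h0.1] : (0:ℝ) ≤ 4 * z 1 - 2)]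
  · obtain ⟨hc, ⟨⟨k2, qn⟩, qa⟩⟩ := hw
    have h0 := (cube2 hc).1
    have h1 := (cube2 hc).2
    simp only [sK2, sQn, sQa, mem_setOf_eq] at k2 qn qa
    have hw0 : w 0 ≤ 1 / 5 := by nlinarith [h0.1]
    nlinarith [mul_le_mul_of_nonneg_left (by linarith [h1.1] : (-2:ℝ) ≤ 4 * w 1 - 2) h0.1]
  · -- `Φm(Trap'_hi) ⊆ SqαN`
    obtain ⟨hc, ⟨⟨⟨u2, u3⟩, q1⟩, k2⟩⟩ := hz
    have h0 := (cube2 hc).1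
    simp only [sU2m, sU3, sQ1, sK2, mem_setOf_eq] at u2 u3 q1 k2
    have hQ0 : (0:ℝ) ≤ 4 * z 1 - 2 := by linarith [h0.1]
    have hD : (0:ℝ) < 1 + 2 * z 0 * (4 * z 1 - 2) := by nlinarith [mul_nonneg h0.1 hQ0]
    have hq := Φm_Q z hD
    set q : ℝ := 4 * Φm z 1 - 2 with hq_def
    have hq0 : q ≤ 0 := by
      by_contra hn; have hn' := not_le.mp hn
      nlinarith [mul_pos hn' hD]
    have hsq : (q * (1 + 2 * z 0 * (4 * z 1 - 2))) * (q * (1 + 2 * z 0 * (4 * z 1 - 2))) =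
        (2 * z 0 - (4 * z 1 - 2)) * (2 * z 0 - (4 * z 1 - 2)) := by rw [hq]
    have hqa : 7 * (q * q) ≤ 1 := by
      by_contra hn; have hn' := not_le.mp hn
      nlinarith [mul_lt_mul_of_pos_right hn' (mul_pos hD hD)]
    have hq2 : -2 ≤ q := by nlinarith
    have hm := Φm_one_mem z (by linarith) (by linarith)
    refine ⟨?_, ⟨⟨?_, ?_⟩, ?_⟩⟩
    · intro i
      fin_cases i
      · simp only [Fin.zero_eta, Φm_zero]; exact h0
      · exact hm
    · simp only [sK2, mem_setOf_eq, Φm_zero]; exact k2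
    · simp only [sQn, mem_setOf_eq]; linarith
    · simp only [sQa, mem_setOf_eq]; exact hqa
  · -- `Φm(SqαN) ⊆ Trap'_hi`
    obtain ⟨hc, ⟨⟨k2, qn⟩, qa⟩⟩ := hw
    have h0 := (cube2 hc).1
    have h1 := (cube2 hc).2
    simp only [sK2, sQn, sQa, mem_setOf_eq] at k2 qn qa
    have hQ0 : 4 * w 1 - 2 ≤ 0 := by linarith
    have hQ1 : -1 ≤ 4 * w 1 - 2 := by nlinarith
    have hw0 : w 0 ≤ 1 / 5 := by nlinarith [h0.1]
    have hD : (0:ℝ) < 1 + 2 * w 0 * (4 * w 1 - 2) := by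
      nlinarith [mul_le_mul_of_nonneg_left (by linarith [h1.1] : (-2:ℝ) ≤ 4 * w 1 - 2) h0.1]
    have h1p : (0:ℝ) < 1 + 4 * w 0 * w 0 := by nlinarith [mul_self_nonneg (w 0)]
    have hq := Φm_Q w hD
    have hdd := Φm_D w hD
    set q : ℝ := 4 * Φm w 1 - 2 with hq_def
    -- `q ≥ P`: `q·D = P − Q ≥ P·D` since `−Q ≥ P²Q`
    have hqP : 2 * w 0 ≤ q := by
      by_contra hn; have hn' := not_le.mp hn
      nlinarith [mul_lt_mul_of_pos_right hn' hD, mul_nonneg (mul_nonneg h0.1 h0.1) (neg_nonneg.2 hQ0)]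
    -- `q ≤ 1`: `q·D = P − Q ≤ D = 1 + PQ` since `(1 − P)(1 + Q) ≥ 0`
    have hq1 : q ≤ 1 := by
      by_contra hn; have hn' := not_le.mp hn
      nlinarith [mul_lt_mul_of_pos_right hn' hD,
        mul_nonneg (by linarith [h0.2] : (0:ℝ) ≤ 1 - 2 * w 0) (by linarith : (0:ℝ) ≤ 1 + (4 * w 1 - 2))]
    have e1 : (2 * w 0 - q) * (1 + 2 * w 0 * (4 * w 1 - 2)) = (4 * w 1 - 2) * (1 + 4 * w 0 * w 0) := by
      rw [sub_mul, hq]; ring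
    have key : 7 * ((2 * w 0 - q) * (2 * w 0 - q)) ≤ (1 + 2 * w 0 * q) * (1 + 2 * w 0 * q) := by
      refine seven_sq_le_of_scaled hD ?_
      rw [e1, hdd]
      nlinarith [mul_pos h1p h1p]
    have hm := Φm_one_mem w (by linarith [h0.1]) (by linarith)
    refine ⟨?_, ⟨⟨⟨?_, ?_⟩, ?_⟩, ?_⟩⟩
    · intro i
      fin_cases i
      · simp only [Fin.zero_eta, Φm_zero]; exact h0
      · exact hm
    · simp only [sU2m, mem_setOf_eq, Φm_zero]; exact hqP
    · simp only [sU3, mem_setOf_eq, Φm_zero]; exact key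
    · simp only [sQ1, mem_setOf_eq]; linarith
    · simp only [sK2, mem_setOf_eq, Φm_zero]; exact k2

/-- **`[AngH | SqαN] ≡ [AngH | Sqα]`** (`ψ ↦ −ψ`). -/
theorem AngHSqαN_Sqα : KZ.of AngHSqαN - KZ.of AngHSqα ∈ KZ.relations := by
  refine AngH_reflect isSemialgebraic_SqαN isSemialgebraic_Sqα (fun _ hz => hz.1) (fun _ hz => hz.1)
    (fun z hz => ?_) (fun w hw => ?_)
  · obtain ⟨hc, ⟨⟨k2, qn⟩, qa⟩⟩ := hz
    simp only [sK2, sQn, sQa, mem_setOf_eq] at k2 qn qa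
    refine ⟨Rf_cube hc, ⟨⟨?_, ?_⟩, ?_⟩⟩
    · simp only [sK2, mem_setOf_eq, Rf_zero]; exact k2
    · simp only [sU1, mem_setOf_eq, Rf_one]; linarith
    · simp only [sQa, mem_setOf_eq, Rf_Q]; nlinarith
  · obtain ⟨hc, ⟨⟨k2, u1⟩, qa⟩⟩ := hw
    simp only [sK2, sU1, sQa, mem_setOf_eq] at k2 u1 qa
    refine ⟨Rf_cube hc, ⟨⟨?_, ?_⟩, ?_⟩⟩
    · simp only [sK2, mem_setOf_eq, Rf_zero]; exact k2
    · simp only [sQn, mem_setOf_eq, Rf_one]; linarith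
    · simp only [sQa, mem_setOf_eq, Rf_Q]; nlinarith

/-- **`[AngH | Ũ₋'] ≡ [AngH | ŨN]`** (`ψ ↦ −ψ`). -/
theorem AngHUmr_UMrN : KZ.of AngHUmr - KZ.of AngHUmrN ∈ KZ.relations := by
  refine AngH_reflect isSemialgebraic_UMr isSemialgebraic_UMrN (fun _ hz => hz.1) (fun _ hz => hz.1)
    (fun z hz => ?_) (fun w hw => ?_)
  · obtain ⟨hc, ⟨⟨⟨u1, u3⟩, u4⟩, u5⟩⟩ := hz
    simp only [sU1, sU3r, sU4, sU5r, mem_setOf_eq] at u1 u3 u4 u5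
    refine ⟨Rf_cube hc, ⟨⟨⟨?_, ?_⟩, ?_⟩, ?_⟩⟩
    · simp only [sQn, mem_setOf_eq, Rf_one]; linarith
    · simp only [sU3, mem_setOf_eq, Rf_zero, Rf_Q]
      have e1 : 2 * z 0 - -(4 * z 1 - 2) = 2 * z 0 + (4 * z 1 - 2) := by ring
      have e2 : 1 + 2 * z 0 * -(4 * z 1 - 2) = 1 - 2 * z 0 * (4 * z 1 - 2) := by ring
      rw [e1, e2]; exact u3
    · simp only [sU4, mem_setOf_eq, Rf_zero, Rf_Q]
      have e : -(4 * z 1 - 2) * -(4 * z 1 - 2) = (4 * z 1 - 2) * (4 * z 1 - 2) := by ring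
      rw [e]; exact u4
    · simp only [sU5r, mem_setOf_eq, Rf_zero]; exact u5
  · obtain ⟨hc, ⟨⟨⟨qn, u3⟩, u4⟩, u5⟩⟩ := hw
    simp only [sQn, sU3, sU4, sU5r, mem_setOf_eq] at qn u3 u4 u5
    refine ⟨Rf_cube hc, ⟨⟨⟨?_, ?_⟩, ?_⟩, ?_⟩⟩
    · simp only [sU1, mem_setOf_eq, Rf_one]; linarith
    · simp only [sU3r, mem_setOf_eq, Rf_zero, Rf_Q]
      have e1 : 2 * w 0 + -(4 * w 1 - 2) = 2 * w 0 - (4 * w 1 - 2) := by ring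
      have e2 : 1 - 2 * w 0 * -(4 * w 1 - 2) = 1 + 2 * w 0 * (4 * w 1 - 2) := by ring
      rw [e1, e2]; exact u3
    · simp only [sU4, mem_setOf_eq, Rf_zero, Rf_Q]
      have e : -(4 * w 1 - 2) * -(4 * w 1 - 2) = (4 * w 1 - 2) * (4 * w 1 - 2) := by ring
      rw [e]; exact u4
    · simp only [sU5r, mem_setOf_eq, Rf_zero]; exact u5

end Fold
end Summit.KontsevichZagierPeriods.RootDecompQuadraticDescent.Pair18Homotopy
end
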